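import Literature.AlgebraicGeometry.Morphisms.ProjectiveFrameSlice
import Literature.AlgebraicGeometry.Morphisms.ProjectiveFrameLocusLinearInvariance
import Literature.AlgebraicGeometry.GroupSchemes.ProjectiveLinearGroupActionProjectiveSpace
import HarnessLib

/-!
# Standard position of framed tuples of points of `𝐏ⁿ_ℤ` under `GL_{n+1}(Γ(T, 𝒪_T))`
# ([MumfordFogartyKirwan1994] Ch. 3 §1 Prop. 3.1: `U_R ≅ PGL(n+1) × σ_R⁻¹(standard frame)`)

Topic `Literature/AlgebraicGeometry/Morphisms`; namespace `Literature.AlgebraicGeometry.Morphisms.ProjFrame`; the sequel of ★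
`ProjectiveFrameSlice` (standard charts `stdChart`, the fundamental frame, the slice) and ★
`ProjectiveFrameLocusLinearInvariance` (the acted `T`-point `M • q := ⟨toSpecΓ, q⟩ ≫ actCore I M` and its chart formula).
THEOREMS ONLY (no definition, no named fact, no instance, no notation, no `sorry`).  Cell hodgecm-mathlib (D-0151), F-DAG
leaf F-8 (8γ-E) «the standard-frame slice represents the frame sub-functor», CUT A of B-p04 (g20)'s census
`B-provers/B-p04/g20/CENSUS-F8-8gammaE-SliceRepresents.B-p04g20.md` §3 (generic `𝐏ⁿ_ℤ` frames, no abelian schemes).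
HC_CM is proved only modulo the 7 printed citations until rung 0 closes; this file discharges none of them.

A tuple `ψ` of `n+2` `T`-valued points of `𝐏ⁿ_ℤ` is IN STANDARD POSITION when every `ψ j` lies in its standard
chart `D₊(x_{stdChart j})` everywhere on `T` (`hstd`) and its global coordinate vectors normalised there are the
FUNDAMENTAL FRAME `(e₀, …, eₙ, e₀ + ⋯ + eₙ)` (`topCoord ψ stdChart hstd = fundamentalFrame`) — the `T`-points of MFK's
`σ_R⁻¹((1,0,…,0), …, (1,1,…,1))`.  For the action of `M ∈ GL_{n+1}(Γ(T, 𝒪_T))` on `T`-valued points (★ (8β-a)):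

* §1 (SP0) **`isUnit_mulVec_topCoord_of_preU_lift_actCore_eq_top`** — the converse of ★ `preU_lift_actCore`: if
  `M • φ_j` lies in `D₊(x_b)` everywhere then the `b`-th coordinate of `M θ_j` is a UNIT (fibrewise: over a residue
  field `M θ_j` has a unit coordinate `b′`, ★ `exists_isUnit_mulVec_apply`, so `M • φ_j = coordPoint (M θ_j) b′` there, ★
  `lift_actCore_eq_coordPoint`, whose locus in `D₊(x_b)` is `D((M θ_j)_b)`, ★ `basicOpen_homRatio`; a global function
  that is a unit in every residue field is a unit).
* §2 (SP1) **`topCoord_lift_actCore_transporterGL_inv`** — the INVERSE TRANSPORTER `(transporterGL θ hP)⁻¹` of a unit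
  frame `θ = topCoord φ c hc` moves `φ` into standard position (★ `carries_transporter`, ★ `topCoord_lift_actCore`).
* §3 (SP2) **`exists_eq_scalar_of_topCoord_lift_actCore_eq_fundamentalFrame`** — if `φ` and `M • φ` are both in
  standard position then `M = u · 1` is a unit scalar (★ `eq_scalar_of_carries_fundamentalFrame_self`: the stabiliser
  of the fundamental frame in `GL_{n+1}` is the scalars — MFK Prop. 3.1 «`PGL(n+1)` acts freely on `U_R`»).
* §4 (SP3) **`lift_actCore_scalar`**, **`lift_actCore_eq_self_of_eq_scalar`** — unit scalars act trivially on every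
  `T`-valued point (★ `projLinAut_scalar`).
* §5 (SP4) **`topCoord_comp_eq_fundamentalFrame`** — standard position is stable under pull-back `T′ → T`.

## References
* [MumfordFogartyKirwan1994] D. Mumford, J. Fogarty, F. Kirwan, *Geometric Invariant Theory*, 3rd ed. (1994), Ch. 3
  §1 Definition 3.3 and Proposition 3.1 (p. 68); Ch. 7 §2 Prop. 7.6 (p. 136).
* [GortzWedhorn2020] U. Görtz, T. Wedhorn, *Algebraic Geometry I*, 2nd ed. (2020), Definition 4.44 (p. 117), (11.15.1).
* [Hartshorne1977] R. Hartshorne, *Algebraic Geometry* (1977), II Thm. 7.1 (p. 150), II Example 7.1.1 (p. 151).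
* [BambergPenttila2023] J. Bamberg, T. Penttila, *Analytic Projective Geometry* (2023), §19.1 Theorem 19.5.
-/

set_option autoImplicit false
set_option backward.isDefEq.respectTransparency false

universe u

open CategoryTheory CategoryTheory.Limits AlgebraicGeometry Matrix HomogeneousLocalization TopologicalSpace
open MvPolynomial (X)
open Literature.AlgebraicGeometry.Morphisms (intU projectiveSpaceInt isPullback_projToSpec_projMap_terminal)
open Literature.AlgebraicGeometry.Motives.ProjBaseChangeRing (mapGraded irrelevant_le_map projToSpec)
open Literature.AlgebraicGeometry.Motives.GeneratingSections
open Literature.AlgebraicGeometry.GroupSchemes.GeneralLinearGroupScheme (intCast actCore actCore_def)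
open Literature.AlgebraicGeometry.GroupSchemes.ProjLinAction (projLinAut projLinAut_scalar)

noncomputable section

namespace Literature.AlgebraicGeometry.Morphisms.ProjFrame

open Literature.AlgebraicGeometry.ProjectiveSpace.ProjFrame

variable (I : Type u) {T T' : Scheme.{u}}

/-! ## §1 (SP0) The acted point lies in `D₊(x_b)` everywhere only if `(M θ)_b` is a unit -/

/-- A global function that is a unit in every residue field is a unit (its non-vanishing locus contains every point;
Mathlib `Scheme.preimage_basicOpen_top`, `Scheme.fromSpecResidueField_apply`). [folklore] -/
private theorem isUnit_of_forall_fromSpecResidueField (s : Γ(T, ⊤))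
    (h : ∀ t : T, IsUnit ((T.fromSpecResidueField t).appTop.hom s)) : IsUnit s := by
  have htop : T.basicOpen s = ⊤ := by
    refine top_le_iff.mp fun t _ => ?_
    have h1 : (Spec (T.residueField t)).basicOpen ((T.fromSpecResidueField t).appTop.hom s) = ⊤ :=
      (Spec (T.residueField t)).basicOpen_of_isUnit (h t)
    have hmem : IsLocalRing.closedPoint (T.residueField t) ∈
        (T.fromSpecResidueField t) ⁻¹ᵁ T.basicOpen s := by
      rw [Scheme.preimage_basicOpen_top]
      exact h1.symm ▸ trivial
    have hmem' : (T.fromSpecResidueField t).base (IsLocalRing.closedPoint (T.residueField t)) ∈ T.basicOpen s :=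
      hmem
    rwa [Scheme.fromSpecResidueField_apply] at hmem'
  have h1 := isUnit_rs_of_le_basicOpen s htop.ge
  rwa [rs_refl] at h1

/-- The global functions of `Spec` of a residue field are field-like: every non-zero element is a unit (Mathlib
`Scheme.ΓSpecIso`; private twin of the (8β-a) plumbing lemma). [folklore] -/
private theorem isUnit_of_ne_zero_ΓSpec_residueField' (t : T) (v : Γ(Spec (T.residueField t), ⊤))
    (hv : v ≠ 0) : IsUnit v := by
  let e : Γ(Spec (T.residueField t), ⊤) ≃+* T.residueField t :=
    (Scheme.ΓSpecIso (T.residueField t)).commRingCatIsoToRingEquiv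
  rw [← MulEquiv.isUnit_map e, isUnit_iff_ne_zero]
  exact e.map_ne_zero_iff.mpr hv

/-- Pre-composition preserves the one-chart hypothesis of a single point: `(x ≫ q)⁻¹ D₊(x_b) = x⁻¹(q⁻¹ D₊(x_b))`.
[cite: Hartshorne1977, II Thm. 7.1 (p. 150)] -/
theorem preU_comp_eq_top_of_preU_eq_top (x : T' ⟶ T) (q : T ⟶ projectiveSpaceInt I) (b : Fin (Nat.card I + 1))
    (hb : preU q b = ⊤) : preU (x ≫ q) b = ⊤ :=
  preU_comp_eq_top (fun _ : Fin (Nat.card I + 2) => q) (fun _ => b) (fun _ => hb) x 0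

/-- **(SP0) If `M • φ_j` lies in `D₊(x_b)` EVERYWHERE on `T`, then `(M θ_j)_b` is a unit of `Γ(T, 𝒪_T)`** (`θ_j` the
global coordinate vector of `φ_j` in the chart `c j`) — the converse of ★ `preU_lift_actCore`.  Fibrewise over the residue
field at `t` (★ `comp_lift_actCore`): there `M θ_j` has SOME unit coordinate `b′` (★ `exists_isUnit_mulVec_apply`), so the
acted point is `coordPoint (M θ_j) b′` (★ `lift_actCore_eq_coordPoint`), which lies in `D₊(x_b)` exactly on
`D((M θ_j)_b · (M θ_j)_{b′}⁻¹)` (★ `basicOpen_homRatio`, ★ `rs_homRatio_coordPoint`); hence `(M θ_j)_b(t) ≠ 0` for every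
`t`, and a global function non-vanishing in every residue field is a unit. [cite: Hartshorne1977, II Example 7.1.1 (p. 151)]
[cite: GortzWedhorn2020, Definition 4.44 (p. 117)] -/
theorem isUnit_mulVec_topCoord_of_preU_lift_actCore_eq_top (φ : Fin (Nat.card I + 2) → (T ⟶ projectiveSpaceInt I))
    (M : GL (Fin (Nat.card I + 1)) Γ(T, ⊤)) (c : Fin (Nat.card I + 2) → Fin (Nat.card I + 1))
    (hc : ∀ j, preU (φ j) (c j) = ⊤) (j : Fin (Nat.card I + 2)) (b : Fin (Nat.card I + 1))
    (hb : letI : Algebra intU.{u} Γ(T, ⊤) := (intCast _).toAlgebra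
      preU ((isPullback_projToSpec_projMap_terminal I Γ(T, ⊤)).lift T.toSpecΓ (φ j) (terminal.hom_ext _ _) ≫
        actCore I M) b = ⊤) :
    IsUnit (((M : Matrix _ _ Γ(T, ⊤)) *ᵥ topCoord φ c hc j) b) := by
  letI : Algebra intU.{u} Γ(T, ⊤) := (intCast _).toAlgebra
  refine isUnit_of_forall_fromSpecResidueField _ fun t => ?_
  letI : Algebra intU.{u} Γ(Spec (T.residueField t), ⊤) := (intCast _).toAlgebra
  have hY := isUnit_of_ne_zero_ΓSpec_residueField' (T := T) t
  -- the pulled-back data over the residue field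
  have hcx : ∀ j, preU (T.fromSpecResidueField t ≫ φ j) (c j) = ⊤ := preU_comp_eq_top φ c hc _
  have hθ : (T.fromSpecResidueField t).appTop.hom (((M : Matrix _ _ Γ(T, ⊤)) *ᵥ topCoord φ c hc j) b) =
      ((Matrix.GeneralLinearGroup.map (T.fromSpecResidueField t).appTop.hom M : Matrix _ _ _) *ᵥ
        topCoord (fun j => T.fromSpecResidueField t ≫ φ j) c hcx j) b := by
    rw [RingHom.map_mulVec, ← mapTuple_topCoord φ c hc (T.fromSpecResidueField t)]
    rfl
  rw [hθ]
  have h1 : IsUnit (topCoord (fun j => T.fromSpecResidueField t ≫ φ j) c hcx j (c j)) := by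
    rw [topCoord_self]
    exact isUnit_one
  obtain ⟨b', hb'⟩ := exists_isUnit_mulVec_apply hY
    (Matrix.GeneralLinearGroup.map (T.fromSpecResidueField t).appTop.hom M)
    (topCoord (fun j => T.fromSpecResidueField t ≫ φ j) c hcx j) (a := c j) h1
  -- over the residue field the acted point is `coordPoint (M θ_j) b′`
  have hp : T.fromSpecResidueField t ≫ ((isPullback_projToSpec_projMap_terminal I Γ(T, ⊤)).lift T.toSpecΓ (φ j)
      (terminal.hom_ext _ _) ≫ actCore I M) =
      coordPoint intU.{u} (((Matrix.GeneralLinearGroup.map (T.fromSpecResidueField t).appTop.hom M :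
        Matrix _ _ _)) *ᵥ topCoord (fun j => T.fromSpecResidueField t ≫ φ j) c hcx j) b' hb' := by
    rw [comp_lift_actCore]
    exact lift_actCore_eq_coordPoint I (T.fromSpecResidueField t ≫ φ j) _ (c j) b' _ (hcx j) (fun _ => rfl) h1 hb'
  -- which lies in `D₊(x_b)` everywhere
  have htop : preU (coordPoint intU.{u} (((Matrix.GeneralLinearGroup.map (T.fromSpecResidueField t).appTop.hom M :
      Matrix _ _ _)) *ᵥ topCoord (fun j => T.fromSpecResidueField t ≫ φ j) c hcx j) b' hb') b = ⊤ := by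
    rw [← hp]
    exact preU_comp_eq_top_of_preU_eq_top I _ _ b hb
  have hW : (⊤ : (Spec (T.residueField t)).Opens) ≤ (Spec (T.residueField t)).basicOpen (homRatio
      (coordPoint intU.{u} (((Matrix.GeneralLinearGroup.map (T.fromSpecResidueField t).appTop.hom M :
        Matrix _ _ _)) *ᵥ topCoord (fun j => T.fromSpecResidueField t ≫ φ j) c hcx j) b' hb') b' b) := by
    rw [basicOpen_homRatio, preU_coordPoint, htop, inf_idem]
  have hu := isUnit_rs_of_le_basicOpen _ hW
  rw [rs_homRatio_coordPoint] at hu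
  exact (IsUnit.mul_iff.mp hu).1

/-! ## §2 (SP1) The inverse transporter moves a unit frame into standard position -/

section Transport

variable (φ : Fin (Nat.card I + 2) → (T ⟶ projectiveSpaceInt I)) (c : Fin (Nat.card I + 2) → Fin (Nat.card I + 1))
  (hc : ∀ j, preU (φ j) (c j) = ⊤) (hP : IsUnitFrame (topCoord φ c hc))

/-- **(SP1, charts) `((transporterGL θ)⁻¹ θ_j)_{stdChart j}` is a unit**: the inverse transporter carries the unit frame
`θ = topCoord φ c hc` to the fundamental frame up to units (★ `carries_transporter`, inverted), whose `stdChart j`-th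
coordinates are `1` (★ `fundamentalFrame_stdChart`). [cite: MumfordFogartyKirwan1994, Ch. 3 §1 Proposition 3.1 (p. 68)] -/
theorem isUnit_transporterGL_inv_mulVec_topCoord_stdChart (j : Fin (Nat.card I + 2)) :
    IsUnit (((((transporterGL (topCoord φ c hc) hP)⁻¹ : GL (Fin (Nat.card I + 1)) Γ(T, ⊤)) :
      Matrix _ _ Γ(T, ⊤)) *ᵥ topCoord φ c hc j) (stdChart (Nat.card I) j)) := by
  obtain ⟨w, hw⟩ := (carries_transporter (topCoord φ c hc) hP).symm j
  rw [hw, Pi.smul_apply, fundamentalFrame_stdChart, smul_eq_mul, mul_one]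
  exact Units.isUnit w

/-- **(SP1) THE INVERSE TRANSPORTER MOVES A UNIT FRAME INTO STANDARD POSITION**: for `M⁻ = (transporterGL θ hP)⁻¹`,
the acted tuple `M⁻ • φ` lies in the standard charts (★ `preU_lift_actCore_tuple`) and its normalised global coordinates
are the fundamental frame: `topCoord (M⁻ • φ) stdChart _ = fundamentalFrame` (★ `topCoord_lift_actCore`: the coordinates
are `M⁻ θ_j = w_j • e_j` normalised at `stdChart j`, i.e. `e_j`). [cite: MumfordFogartyKirwan1994, Ch. 3 §1 Proposition 3.1 (p. 68)]
[cite: Hartshorne1977, II Example 7.1.1 (p. 151)] -/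
theorem topCoord_lift_actCore_transporterGL_inv :
    letI : Algebra intU.{u} Γ(T, ⊤) := (intCast _).toAlgebra
    topCoord (fun j => (isPullback_projToSpec_projMap_terminal I Γ(T, ⊤)).lift T.toSpecΓ (φ j)
        (terminal.hom_ext _ _) ≫ actCore I (transporterGL (topCoord φ c hc) hP)⁻¹) (stdChart (Nat.card I))
      (preU_lift_actCore_tuple I φ (transporterGL (topCoord φ c hc) hP)⁻¹ c (stdChart (Nat.card I)) hc
        (isUnit_transporterGL_inv_mulVec_topCoord_stdChart I φ c hc hP)) =
      fundamentalFrame (Nat.card I) Γ(T, ⊤) := by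
  letI : Algebra intU.{u} Γ(T, ⊤) := (intCast _).toAlgebra
  funext j i
  rw [topCoord_lift_actCore I φ _ c (stdChart (Nat.card I)) hc
    (isUnit_transporterGL_inv_mulVec_topCoord_stdChart I φ c hc hP) j i]
  obtain ⟨w, hw⟩ := (carries_transporter (topCoord φ c hc) hP).symm j
  have hunit : ((isUnit_transporterGL_inv_mulVec_topCoord_stdChart I φ c hc hP j).unit : Γ(T, ⊤)) = w := by
    rw [IsUnit.unit_spec, hw, Pi.smul_apply, fundamentalFrame_stdChart, smul_eq_mul, mul_one]
  rw [Units.mul_inv_eq_iff_eq_mul, hunit, hw, Pi.smul_apply, smul_eq_mul, mul_comm]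

end Transport

/-! ## §3 (SP2) The stabiliser of standard position is the scalars -/

/-- **(SP2) IF `φ` AND `M • φ` ARE BOTH IN STANDARD POSITION THEN `M` IS A UNIT SCALAR.**  By (SP0) the coordinates
`(M e_j)_{stdChart j}` are units, so ★ `topCoord_lift_actCore` reads the standard-position hypothesis of `M • φ` as
`M e_j = w_j • e_j` for the fundamental frame `(e_j)`: `M` carries the fundamental frame to itself, hence is a scalar (★
`eq_scalar_of_carries_fundamentalFrame_self`) — MFK Prop. 3.1: `PGL(n+1)` acts FREELY on `U_R`, the stabiliser of the
standard frame is trivial. [cite: MumfordFogartyKirwan1994, Ch. 3 §1 Proposition 3.1 (p. 68)]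
[cite: BambergPenttila2023, §19.1 Theorem 19.5] -/
theorem exists_eq_scalar_of_topCoord_lift_actCore_eq_fundamentalFrame
    (φ : Fin (Nat.card I + 2) → (T ⟶ projectiveSpaceInt I))
    (hstd : ∀ j, preU (φ j) (stdChart (Nat.card I) j) = ⊤)
    (hfund : topCoord φ (stdChart (Nat.card I)) hstd = fundamentalFrame (Nat.card I) Γ(T, ⊤))
    (M : GL (Fin (Nat.card I + 1)) Γ(T, ⊤))
    (hstd' : letI : Algebra intU.{u} Γ(T, ⊤) := (intCast _).toAlgebra
      ∀ j, preU ((isPullback_projToSpec_projMap_terminal I Γ(T, ⊤)).lift T.toSpecΓ (φ j) (terminal.hom_ext _ _) ≫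
        actCore I M) (stdChart (Nat.card I) j) = ⊤)
    (hfund' : letI : Algebra intU.{u} Γ(T, ⊤) := (intCast _).toAlgebra
      topCoord (fun j => (isPullback_projToSpec_projMap_terminal I Γ(T, ⊤)).lift T.toSpecΓ (φ j)
        (terminal.hom_ext _ _) ≫ actCore I M) (stdChart (Nat.card I)) hstd' = fundamentalFrame (Nat.card I) Γ(T, ⊤)) :
    ∃ u : (Γ(T, ⊤))ˣ, M = Matrix.GeneralLinearGroup.scalar (Fin (Nat.card I + 1)) u := by
  letI : Algebra intU.{u} Γ(T, ⊤) := (intCast _).toAlgebra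
  have hb : ∀ j, IsUnit (((M : Matrix _ _ Γ(T, ⊤)) *ᵥ topCoord φ (stdChart (Nat.card I)) hstd j)
      (stdChart (Nat.card I) j)) := fun j =>
    isUnit_mulVec_topCoord_of_preU_lift_actCore_eq_top I φ M (stdChart (Nat.card I)) hstd j _ (hstd' j)
  apply eq_scalar_of_carries_fundamentalFrame_self
  intro j
  refine ⟨(hb j).unit, ?_⟩
  have e : ∀ i, fundamentalFrame (Nat.card I) Γ(T, ⊤) j i =
      ((M : Matrix _ _ Γ(T, ⊤)) *ᵥ topCoord φ (stdChart (Nat.card I)) hstd j) i *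
        (((hb j).unit⁻¹ : (Γ(T, ⊤))ˣ) : Γ(T, ⊤)) := fun i => by
    rw [← topCoord_lift_actCore I φ M (stdChart (Nat.card I)) (stdChart (Nat.card I)) hstd hb j i]
    exact (congrFun (congrFun hfund' j) i).symm
  have hθj : topCoord φ (stdChart (Nat.card I)) hstd j = fundamentalFrame (Nat.card I) Γ(T, ⊤) j :=
    congrFun hfund j
  rw [← hθj]
  funext i
  rw [Pi.smul_apply, smul_eq_mul]
  calc ((M : Matrix _ _ Γ(T, ⊤)) *ᵥ topCoord φ (stdChart (Nat.card I)) hstd j) i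
      = ((M : Matrix _ _ Γ(T, ⊤)) *ᵥ topCoord φ (stdChart (Nat.card I)) hstd j) i *
          (((hb j).unit⁻¹ : (Γ(T, ⊤))ˣ) : Γ(T, ⊤)) * (((hb j).unit : (Γ(T, ⊤))ˣ) : Γ(T, ⊤)) := by
        rw [Units.inv_mul_cancel_right]
    _ = fundamentalFrame (Nat.card I) Γ(T, ⊤) j i * (((hb j).unit : (Γ(T, ⊤))ˣ) : Γ(T, ⊤)) := by rw [← e i]
    _ = (((hb j).unit : (Γ(T, ⊤))ˣ) : Γ(T, ⊤)) * topCoord φ (stdChart (Nat.card I)) hstd j i := by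
        rw [mul_comm]
        exact congrArg (fun a => (((hb j).unit : (Γ(T, ⊤))ˣ) : Γ(T, ⊤)) * a) (congrFun hθj i).symm

/-- (SP2), matrix form: `(M : Matrix) = u • 1`. [cite: MumfordFogartyKirwan1994, Ch. 3 §1 Proposition 3.1 (p. 68)] -/
theorem exists_coe_eq_smul_one_of_topCoord_lift_actCore_eq_fundamentalFrame
    (φ : Fin (Nat.card I + 2) → (T ⟶ projectiveSpaceInt I))
    (hstd : ∀ j, preU (φ j) (stdChart (Nat.card I) j) = ⊤)
    (hfund : topCoord φ (stdChart (Nat.card I)) hstd = fundamentalFrame (Nat.card I) Γ(T, ⊤))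
    (M : GL (Fin (Nat.card I + 1)) Γ(T, ⊤))
    (hstd' : letI : Algebra intU.{u} Γ(T, ⊤) := (intCast _).toAlgebra
      ∀ j, preU ((isPullback_projToSpec_projMap_terminal I Γ(T, ⊤)).lift T.toSpecΓ (φ j) (terminal.hom_ext _ _) ≫
        actCore I M) (stdChart (Nat.card I) j) = ⊤)
    (hfund' : letI : Algebra intU.{u} Γ(T, ⊤) := (intCast _).toAlgebra
      topCoord (fun j => (isPullback_projToSpec_projMap_terminal I Γ(T, ⊤)).lift T.toSpecΓ (φ j)
        (terminal.hom_ext _ _) ≫ actCore I M) (stdChart (Nat.card I)) hstd' = fundamentalFrame (Nat.card I) Γ(T, ⊤)) :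
    ∃ u : (Γ(T, ⊤))ˣ, (M : Matrix (Fin (Nat.card I + 1)) (Fin (Nat.card I + 1)) Γ(T, ⊤)) =
      (u : Γ(T, ⊤)) • (1 : Matrix (Fin (Nat.card I + 1)) (Fin (Nat.card I + 1)) Γ(T, ⊤)) := by
  obtain ⟨u, hu⟩ := exists_eq_scalar_of_topCoord_lift_actCore_eq_fundamentalFrame I φ hstd hfund M hstd' hfund'
  exact ⟨u, by rw [hu, Matrix.GeneralLinearGroup.coe_scalar, Matrix.scalar_apply, Matrix.smul_one_eq_diagonal]⟩

/-! ## §4 (SP3) Unit scalars act trivially -/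

/-- **(SP3) A unit scalar matrix fixes every `T`-valued point of `𝐏ⁿ_ℤ`**: `(u · 1) • q = q` (★ `projLinAut_scalar`: the
scalar substitution is the identity of `Proj`; then `⟨toSpecΓ, q⟩ ≫ pr₂ = q`). [cite: GortzWedhorn2020, (11.15.1)]
[cite: MumfordFogartyKirwan1994, Ch. 3 §1 Proposition 3.1 (p. 68)] -/
theorem lift_actCore_scalar (q : T ⟶ projectiveSpaceInt I) (u : (Γ(T, ⊤))ˣ) :
    letI : Algebra intU.{u} Γ(T, ⊤) := (intCast _).toAlgebra
    (isPullback_projToSpec_projMap_terminal I Γ(T, ⊤)).lift T.toSpecΓ q (terminal.hom_ext _ _) ≫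
      actCore I (Matrix.GeneralLinearGroup.scalar (Fin (Nat.card I + 1)) u) = q := by
  letI : Algebra intU.{u} Γ(T, ⊤) := (intCast _).toAlgebra
  rw [actCore_def, projLinAut_scalar]
  change _ ≫ 𝟙 _ ≫ _ = q
  rw [Category.id_comp, IsPullback.lift_snd]

/-- **(SP3′) `M • q = q` whenever `M = u · 1`.** [cite: GortzWedhorn2020, (11.15.1)] -/
theorem lift_actCore_eq_self_of_eq_scalar (q : T ⟶ projectiveSpaceInt I) (M : GL (Fin (Nat.card I + 1)) Γ(T, ⊤))
    (u : (Γ(T, ⊤))ˣ) (hM : M = Matrix.GeneralLinearGroup.scalar (Fin (Nat.card I + 1)) u) :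
    letI : Algebra intU.{u} Γ(T, ⊤) := (intCast _).toAlgebra
    (isPullback_projToSpec_projMap_terminal I Γ(T, ⊤)).lift T.toSpecΓ q (terminal.hom_ext _ _) ≫ actCore I M = q := by
  rw [hM]
  exact lift_actCore_scalar I q u

/-! ## §5 (SP4) Standard position pulls back -/

/-- **(SP4) Standard position is stable under pull-back**: for `x : T′ → T`, the tuple `(x ≫ φ_j)_j` lies in the standard
charts (★ `preU_comp_eq_top`) and its normalised global coordinates are again the fundamental frame (★
`mapTuple_topCoord`, ★ `mapTuple_fundamentalFrame`). [cite: Hartshorne1977, II Thm. 7.1 (p. 150)]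
[cite: MumfordFogartyKirwan1994, Ch. 3 §1 Proposition 3.1 (p. 68)] -/
theorem topCoord_comp_eq_fundamentalFrame (φ : Fin (Nat.card I + 2) → (T ⟶ projectiveSpaceInt I))
    (hstd : ∀ j, preU (φ j) (stdChart (Nat.card I) j) = ⊤)
    (hfund : topCoord φ (stdChart (Nat.card I)) hstd = fundamentalFrame (Nat.card I) Γ(T, ⊤)) (x : T' ⟶ T) :
    topCoord (fun j => x ≫ φ j) (stdChart (Nat.card I)) (preU_comp_eq_top φ (stdChart (Nat.card I)) hstd x) =
      fundamentalFrame (Nat.card I) Γ(T', ⊤) := by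
  rw [← mapTuple_topCoord φ (stdChart (Nat.card I)) hstd x, hfund, mapTuple_fundamentalFrame]

end Literature.AlgebraicGeometry.Morphisms.ProjFrame

end
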